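import Summits.BirchSwinnertonDyer.BirchSwinnertonDyer.Theorems.UniversalToricDescentRatwallThinCombContRigidityUpTo
import HarnessLib

/-!
# Line `ratwall_thin_comb` on the RATIONAL WALL `RationalSplitIMCInclusionAtThree` (stmt-BirchSwinnertonDyer-24207): cross-period
# rigidity up to powers of `p` against a toric frame known only UP TO A CONSTANT AND TWO INDEPENDENT GRADINGS `X^a · Y^b`
# (♯♯-currency; `--supports stmt-BirchSwinnertonDyer-24207`; cell `pub/bsd-wall`, LEAD `cruxlead-24207` g3; any prime `p`; sorry-free;
# no named fact; imports no `Theses` module)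

WHY. The v3/v4 skeleton of line `ratwall_thin_comb` pins the two-variable toric function `L₂` by
`IsToricTwoVarLFunctionUpTo C` (values `C · ι⁻¹(display(ψ, a, b)) · Ω_p^{2(a+b)}`): ONE constant `C` and ONE grading `(a+b)`. At an
ADDITIVE prime `p` of `f` (`p^c ∥ N`, `c ≥ 2`, `a_p = 0`) the interpolation formula of the `𝛉`-dominant two-variable `p`-adic `L`-function
carries, besides the display read off the level (`𝓔(f, ψ) = 1`), the local `ε`-factor of the supercuspidal `π_{f,p}` twisted by the
unramified unit-root character — in Hao–Loeffler's formula the factor `λ_p(g)^b (p^{t+1}/α)^b` with `b = c`, `t + 1 =` the `𝔭′`-weight,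
`α` the unit root of the CM form (Forum Math. 2025, Thm. 3.5; it «is essentially the local ε-factor», loc. cit. §1.2) — whose `p`-adic
size `p^{c·b}` is graded by ONE of the two weights, not by `a + b`. Such a factor is absorbed by neither `C` nor `Ω_p^{2(a+b)}`, but it
IS absorbed by two independent gradings `X^a Y^b` (`X, Y ∈ ℂ_pˣ`), up to a unit of `Λ₂` (a group-like element), to which every consumer
of the line is insensitive. This file provides the ♯♯-form of the cross-period rigidity step, so that the LEAD can register the weaker
(and, at additive `p`, the only plausible) existence stub `stub_toricExistsUpTo₂` without touching `Literature/`: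

* **`eq_zero_or_rel_spec_of_toricUpTo₂_values`**: as `ContRigidityUpTo.eq_zero_or_rel_spec_of_toricUpTo_values` (p731441), with the
  values hypothesis `C · X^a · Y^b · ι⁻¹(toricInterpolationValue p f 𝔭 𝔭′ ψ a b Ω′_K (L 1))` (`C, X, Y ≠ 0`; no `Ω′_p`). Proof: a fourth
  root `Ω′_p` of `X·Y` in `ℂ_p` (algebraically closed) turns the central-ray values `C (XY)^n ι⁻¹(…)` into `C ι⁻¹(…) Ω′_p^{4n}`, which is
  all `ContRigidityUpTo.eq_zero_or_rel_of_isBDPLFunction_of_contUpTo` consumes; the rest is the p731441 argument verbatim (`φ(𝔭′) = φ(𝔭)⁻¹`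
  on the anticyclotomic line, `toricInterpolationValue_diag_eq_bdpInterpolationValue`, line geometry, `LineValue`).

HONEST FRAMING. Pure bookkeeping about interpolation predicates; it neither constructs a `p`-adic `L`-function nor asserts that one
exists; BSD is proved for no curve by this file. References: [CastellaWan2023] Thm. 2.11, Cor. 2.12 (arXiv:1607.02019 §2.4); [Castella2018]
Thm. 3.1; [HaoLoeffler2025] Thm. 3.5 (arXiv:2405.12611, Forum Math. 2025; the `ε`-factor term at `p`-level `p^b`); [Washington1997] §7.1–7.2.
-/

noncomputable section

open scoped Classical Topology

set_option linter.dupNamespace false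
set_option autoImplicit false

namespace Summit.BirchSwinnertonDyer.BirchSwinnertonDyer.Theorems.UniversalToricDescentRatwallThinComb.ContRigidityUpTo

open Filter PowerSeries NumberField IsDedekindDomain Field
  Literature.NumberTheory.EllipticCurves Literature.NumberTheory.EllipticCurves.ModularForms
  Literature.NumberTheory.GaloisRepresentations
  Summit.BirchSwinnertonDyer.Rank1Residual.X11b
  Summit.BirchSwinnertonDyer.Rank1Residual.X11b.Halves
  Summit.BirchSwinnertonDyer.BirchSwinnertonDyer.Theorems.CongruentShaFreeCutCharacterSupply
  Summit.BirchSwinnertonDyer.BirchSwinnertonDyer.Theorems.CongruentShaFreeCutBDPUpToPowerMapIdentity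
  Summit.BirchSwinnertonDyer.BirchSwinnertonDyer.Theorems.CongruentShaFreeCutPowerMapSeriesRigidity
  Summit.BirchSwinnertonDyer.BirchSwinnertonDyer.Theorems.UniversalToricDescentTwinSplit
  Summit.BirchSwinnertonDyer.BirchSwinnertonDyer.Theorems.UniversalToricDescentThinComb

section ToricTwoGradings

variable {p : ℕ} [Fact p.Prime]

/-- A product of two non-zero elements of `ℂ_p` has a non-zero fourth root (`ℂ_p` is algebraically closed). [folklore] -/
theorem exists_fourth_root_ne_zero {X Y : ℂ_[p]} (hX : X ≠ 0) (hY : Y ≠ 0) :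
    ∃ Ω : ℂ_[p], Ω ≠ 0 ∧ Ω ^ 4 = X * Y := by
  obtain ⟨Ω, hΩ⟩ := IsAlgClosed.exists_pow_nat_eq (X * Y) (by norm_num : 0 < 4)
  refine ⟨Ω, ?_, hΩ⟩
  rintro rfl
  rw [zero_pow (by norm_num)] at hΩ
  exact mul_ne_zero hX hY hΩ.symm

/-- **K3 of line `ratwall_thin_comb` in ♯♯-currency (two independent gradings).** `K` imaginary quadratic, `p = 𝔭𝔭′` split, `κ`
anticyclotomic with topological generator `γ`, `(κ₁, κ₂; γ₁, γ₂)` a generator pair with the v2 frame relations `γ₁γ⁻¹ ∈ ker κ`,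
`γ₂(γ^{p^k})⁻¹ ∈ ker κ`. If `L` is a BDP frame of `f` at `(Ω_K, Ω_p)` (the crux's handed frame) and `L₂ ∈ R₀⟦T₁⟧⟦T₂⟧` takes at the
interpolation point of every `(ψ, a, b, r)` of the critical cone (ψ everywhere unramified of type `(a, −b)`, `a, b ≥ 1`, avatar `r` through the
pair) admitting an entire continuation `Lc` of `L(f/K, ψ, s)` the value `C · X^a · Y^b · ι⁻¹(toricInterpolationValue p f 𝔭 𝔭′ ψ a b Ω′_K (Lc 1))`
with `C, X, Y ∈ ℂ_pˣ` — the display of Castella–Wan Thm. 2.11 up to a constant and TWO INDEPENDENT gradings (`X = Y = Ω′_p²` is the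
♯-form; the extra freedom absorbs the size `p^{c·b}` of the local `ε`-factor at an additive `p`, Hao–Loeffler Thm. 3.5) — then `L = 0` or
`p^a·spec (p^k) L₂ = p^b·(w·L)` for some `a b : ℕ` and a unit `w` of `R₀⟦T⟧`. Only the CENTRAL RAY `a = b = n` is used, where
`X^n Y^n = Ω′_p^{4n}` for a fourth root `Ω′_p` of `XY`. [cite: CastellaWan2023, §2.4 Thm. 2.11 and Cor. 2.12 (arXiv:1607.02019)]
[cite: Castella2018, Thm. 3.1] [cite: HaoLoeffler2025, Thm. 3.5 (arXiv:2405.12611)] -/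
theorem eq_zero_or_rel_spec_of_toricUpTo₂_values
    (K : Type) [Field K] [NumberField K] (N : ℕ) (f : CuspForm (CongruenceSubgroup.Gamma0 N) 2)
    (hK : IsImaginaryQuadratic K) (κ : ZpExtension K p) (hκ : κ.IsAnticyclotomic) (γ : Field.absoluteGaloisGroup K)
    (hγ : κ.IsTopGenerator γ) (𝔭 : HeightOneSpectrum (𝓞 K)) (h𝔭 : ((p : ℕ) : 𝓞 K) ∈ 𝔭.asIdeal)
    (𝔭' : HeightOneSpectrum (𝓞 K)) (h𝔭' : ((p : ℕ) : 𝓞 K) ∈ 𝔭'.asIdeal) (hne : 𝔭' ≠ 𝔭)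
    (ι : PadicAlgCl p ≃+* ℂ) (κ₁ κ₂ : ZpExtension K p) (γ₁ γ₂ : Field.absoluteGaloisGroup K) (k : ℕ)
    (hpair : ZpExtension.IsTopGeneratorPair κ₁ κ₂ γ₁ γ₂)
    (hγ₁ : γ₁ * γ⁻¹ ∈ κ.kerSubgroup) (hγ₂ : γ₂ * (γ ^ (p ^ k))⁻¹ ∈ κ.kerSubgroup)
    {ΩK : ℂ} {Ωp : ℂ_[p]} {L : UnrSeries p} (hΩK : ΩK ≠ 0) (hΩp : Ωp ≠ 0)
    (hL : IsBDPLFunction ι 𝔭 κ γ f ΩK Ωp L)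
    {ΩK' : ℂ} {C X Y : ℂ_[p]} {L₂ : PowerSeries (UnrSeries p)} (hΩK' : ΩK' ≠ 0) (hC : C ≠ 0) (hX : X ≠ 0)
    (hY : Y ≠ 0)
    (hL₂ : ∀ (ψ : HeckeCharacter K) (a b : ℕ), 1 ≤ a → 1 ≤ b →
      ψ.HasInfinityType (fun _ ↦ (a : ℤ)) (fun _ ↦ -(b : ℤ)) →
      (∀ w : HeightOneSpectrum (𝓞 K), ψ.IsUnramifiedAt w) →
      ∀ r : FramedGaloisRep K (PadicAlgCl p) 1, IsPAdicAvatarOf ι ψ r → FactorsThroughPair κ₁ κ₂ r →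
      ∀ Lc : ℂ → ℂ, Differentiable ℂ Lc →
        (∀ s : ℂ, (a : ℝ) + 2 < s.re → Lc s = rankinSelbergEulerProductHecke f ψ s) →
        UnrSeries.HasValueAt₂ L₂ (avatarValueAt r γ₁ - 1) (avatarValueAt r γ₂ - 1)
          (C * X ^ a * Y ^ b *
            ((((ι.symm (toricInterpolationValue p f 𝔭 𝔭' ψ a b ΩK' (Lc 1))) : PadicAlgCl p) : ℂ_[p])))) :
    L = 0 ∨ ∃ (a b : ℕ) (w : UnrSeries p), IsUnit w ∧
      PowerSeries.C (((p : ℕ) : unrIntegers p) ^ a) * TwoVarSubst.spec (p ^ k) L₂ =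
        PowerSeries.C (((p : ℕ) : unrIntegers p) ^ b) * (w * L) := by
  -- a fourth root of `X·Y` plays the rôle of the `p`-adic period `Ω′_p` on the central ray
  obtain ⟨Ωp', hΩp'0, hΩp'⟩ := exists_fourth_root_ne_zero hX hY
  refine eq_zero_or_rel_of_isBDPLFunction_of_contUpTo hK hκ hγ hΩK hΩK' hΩp hΩp'0 hC hL ?_
  intro φ n hn hunr hinf r hr hκr hcont
  obtain ⟨Lc, hLd, hLe⟩ := hcont
  -- the avatar factors through the pair
  have hpr : FactorsThroughPair κ₁ κ₂ r :=
    PrintCf2.GeneratorPairSupply.factorsThroughPair_of_factorsThroughZp_of_isImaginaryQuadratic hK hpair κ hκr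
  -- `φ(𝔭′) = φ(𝔭)⁻¹`
  haveI : IsCMField K := hK.isCMField
  have hφc := KatzLineFrame.galConj_complexConj_eq_inv_of_factorsThroughZp hK ι hκ hr hκr hunr
  have hsmul : IsCMField.complexConj K • 𝔭 = 𝔭' :=
    KatzLineFrame.complexConj_smul_eq_of_ne hK (Fact.out : p.Prime) h𝔭 h𝔭' hne
  have hψ : heckeValueExtZero φ 𝔭' = (heckeValueExtZero φ 𝔭)⁻¹ := by
    rw [heckeValueExtZero_of_isUnramifiedAt (hunr _), heckeValueExtZero_of_isUnramifiedAt (hunr _), ← hsmul]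
    exact KatzLineFrame.valueAtUniformizer_smul_of_galConj_eq_inv hφc hunr 𝔭
  -- the ♯♯ two-variable value on the central ray
  have hLe' : ∀ s : ℂ, (n : ℝ) + 2 < s.re → Lc s = rankinSelbergEulerProductHecke f φ s :=
    fun s hs ↦ hLe s (by have : (0 : ℝ) ≤ n := Nat.cast_nonneg n; linarith)
  have h2 := hL₂ φ n n hn hn hinf hunr r hr hpr Lc hLd hLe'
  rw [← rankinSelbergValueHecke_eq hLd hLe 1, toricInterpolationValue_diag_eq_bdpInterpolationValue p f hψ n ΩK'] at h2
  have e : C * X ^ n * Y ^ n * ((((ι.symm (bdpInterpolationValue p f 𝔭 φ n ΩK')) : PadicAlgCl p) : ℂ_[p])) =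
      C * ((((ι.symm (bdpInterpolationValue p f 𝔭 φ n ΩK')) : PadicAlgCl p) : ℂ_[p]) * Ωp' ^ (4 * n)) := by
    rw [pow_mul, hΩp', mul_pow]; ring
  rw [e] at h2
  -- read on the line
  rw [LineGeometry.interpolationPoint_mem_line hκr hγ₁ hγ₂, LineGeometry.avatarValueAt_frame_fst hκr hγ₁] at h2
  have hx : ‖avatarValueAt r γ - 1‖ < 1 := ZpExtension.norm_avatarValueAt_sub_one_lt hκr hγ
  exact (LineValue.hasValueAt₂_line_iff_hasValueAt_spec (p ^ k) L₂ hx _).mp h2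

/-- **The ♯-form is a ♯♯-form**: values `C · ι⁻¹(…) · Ω_p^{2(a+b)}` are values `C · X^a · Y^b · ι⁻¹(…)` with `X = Y = Ω_p²`
(bookkeeping identity on the value, for transporting ♯-frames into ♯♯-statements). [cite: CastellaWan2023, §2.4 Thm. 2.11 (arXiv:1607.02019)] -/
theorem sharp_value_eq_twoGradings (C Ωp v : ℂ_[p]) (a b : ℕ) :
    C * (v * Ωp ^ (2 * (a + b))) = C * (Ωp ^ 2) ^ a * (Ωp ^ 2) ^ b * v := by
  ring

end ToricTwoGradings

end Summit.BirchSwinnertonDyer.BirchSwinnertonDyer.Theorems.UniversalToricDescentRatwallThinComb.ContRigidityUpTo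

end
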